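import Literature.Topology.FourManifolds.FishtailSection
import Literature.Topology.FourManifolds.FishtailCoordinates
import Mathlib.Analysis.SpecialFunctions.Trigonometric.ArctanDeriv
import HarnessLib

/-!
# The model side of the `-1`-surgery chart: Gompf's handle identification `Λ`

The fishtail end model (`FishtailEndModel.lean`) is the mapping torus over the base `t` of the
shear twist `Ψ (z₁, z₂, z₃) = (z₁, z₂, z₃ e^{ig(n)})` (`z₂ = e^{in}`). Over the base torus
`(n, t)` the last factor is an `𝕊¹`-bundle of Euler number one; it is trivial off a small disc
about `q₀ = (n_j, t ≡ 1)` (the *hole*), where the model is glued to the shell of Gompf's box `N`,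
while over the hole it is glued to the boundary of a tubular neighbourhood of Gompf's disc `D`
(R. Gompf, *More Cappell–Shaneson spheres are standard*, Algebr. Geom. Topol. 10 (2010),
Lemma 2.2: `Φ = N ∪ 2-handle attached along γ with framing ∓1`). This file is the explicit
identification `Λ` of the hole region with `D × 𝕊¹` (disc coordinate `ζ`, normal angle `β`):

* The base point near the hole is read in the cap chart of the target
  (`FishtailCoordinates.lean`): `d = capPt ε n (sTop h t)` with
  `Literature.Topology.FourManifolds.sTop h t = 3/4 - h tan(2π(t - 1))` (the top of the box is flat
  and traversed with `s` decreasing in `t`, the orientation for which the meridian of the model has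
  zero winding in the normal angle), inverse `Literature.Topology.FourManifolds.tOfS`.
* The seam plateau `Literature.Topology.FourManifolds.tauT η` (`0` for `t ≤ 1 - η`, `1` for
  `t ≥ 1 + η`), read in the chart `Literature.Topology.FourManifolds.tauD`; the trivialising
  correction of the model bundle is `ℓ_N = ℓ₂ - T`, `T = 2π g₁ τ` (`g₁ = [|d| > t_j]` is the
  real lift of the clutching function `g` cut at `n_j`, cf. `seamLift`).
* The **smooth lift** `Literature.Topology.FourManifolds.modelLift = -seamCorrG t_j (1 - τ)` of
  the degree-zero circle map `e^{i(ϑ + T)}` on the collar annulus (`contDiffAt_modelLift`, an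
  instance of the cancellation lemma `contDiffAt_seamCorrG`), its cut-off
  `Literature.Topology.FourManifolds.modelS` (smooth on the whole hole disc), and the
  identification `Literature.Topology.FourManifolds.fishLambda (v, ℓ₂) = (c v e^{-i(S̃ - ℓ₂)}, S̃ - ℓ₂)`
  with explicit inverse `Literature.Topology.FourManifolds.fishLambdaInv`
  (`fishLambdaInv_fishLambda`, `fishLambda_fishLambdaInv`), smoothness, and the **collar
  identities** (`fishLambda_fst_eq`, `exp_neg_modelLift_mul_unit`): on the collar the disc
  coordinate has angle `ℓ₂ - T` (the trivialised fibre coordinate) and the normal angle is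
  `ϑ + T - ℓ₂` — exactly the corner-chart description of the box shell (`cornerChart`), which is
  what makes the two gluings of the model match.

Everything is proved; no named facts.

## References

* R. E. Gompf, *More Cappell–Shaneson spheres are standard*, Algebr. Geom. Topol. 10 (2010)
  1665–1681, Lemma 2.2 and its proof. [GompfAGT2010]
-/

noncomputable section

open scoped Real ContDiff Topology
open Set Function Complex Filter

namespace Literature.Topology.FourManifolds

/-! ### The base coordinate near the hole -/

section Base

variable (h : ℝ)

/-- **The top of the box read from the model base**: `sTop h t = 3/4 - h tan(2π(t - 1))`. [cite: GompfAGT2010, Thm 2.1 (proof: the box N = D × T², D ⊂ I_θ × I)] -/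
def sTop (h t : ℝ) : ℝ := 3 / 4 - h * Real.tan (2 * π * (t - 1))

/-- **The model base coordinate of a point of the top**: `tOfS h s = 1 - arctan((s - 3/4)/h)/2π`. [folklore] -/
def tOfS (h s : ℝ) : ℝ := 1 - Real.arctan ((s - 3 / 4) / h) / (2 * π)

variable {h}

/-- `tOfS (sTop t) = t` for `|t - 1| < 1/4` (and `h ≠ 0`). [folklore] -/
theorem tOfS_sTop (hh : h ≠ 0) {t : ℝ} (h1 : 3 / 4 < t) (h2 : t < 5 / 4) : tOfS h (sTop h t) = t := by
  have hπ := Real.pi_pos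
  rw [tOfS, sTop, show (3 / 4 - h * Real.tan (2 * π * (t - 1)) - 3 / 4) / h = -Real.tan (2 * π * (t - 1)) by
    field_simp; ring, Real.arctan_neg,
    Real.arctan_tan (by nlinarith) (by nlinarith)]
  field_simp
  ring

/-- `sTop (tOfS s) = s` (for `h ≠ 0`). [folklore] -/
theorem sTop_tOfS (hh : h ≠ 0) (s : ℝ) : sTop h (tOfS h s) = s := by
  have hπ := Real.pi_pos
  rw [sTop, tOfS, show 2 * π * (1 - Real.arctan ((s - 3 / 4) / h) / (2 * π) - 1) =
    -Real.arctan ((s - 3 / 4) / h) by field_simp; ring, Real.tan_neg, Real.tan_arctan]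
  field_simp
  ring

/-- `sTop` is smooth on `|t - 1| < 1/4`. [folklore] -/
theorem contDiffAt_sTop {t : ℝ} (h1 : 3 / 4 < t) (h2 : t < 5 / 4) : ContDiffAt ℝ ∞ (sTop h) t := by
  have hπ := Real.pi_pos
  have hcos : Real.cos (2 * π * (t - 1)) ≠ 0 :=
    (Real.cos_pos_of_mem_Ioo ⟨by nlinarith, by nlinarith⟩).ne'
  have ht : ContDiffAt ℝ ∞ Real.tan (2 * π * (t - 1)) := Real.contDiffAt_tan.2 hcos
  have hi : ContDiffAt ℝ ∞ (fun x : ℝ ↦ 2 * π * (x - 1)) t :=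
    (contDiff_const.mul (contDiff_id.sub contDiff_const)).contDiffAt
  exact contDiffAt_const.sub (contDiffAt_const.mul
    (ContDiffAt.comp (g := Real.tan) (f := fun x : ℝ ↦ 2 * π * (x - 1)) t ht hi))

/-- `tOfS` is smooth. [folklore] -/
theorem contDiff_tOfS (h : ℝ) : ContDiff ℝ ∞ (tOfS h) :=
  contDiff_const.sub ((Real.contDiff_arctan.comp ((contDiff_id.sub contDiff_const).div_const _)).div_const _)

end Base

/-! ### The seam plateau -/

section Plateau

variable (h η : ℝ)

/-- **The seam plateau** `τ(t) = λ((t - 1 + η)/2η)`: `0` for `t ≤ 1 - η`, `1` for `t ≥ 1 + η`. [folklore] -/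
def tauT (η t : ℝ) : ℝ := Real.smoothTransition ((t - 1 + η) / (2 * η))

/-- The plateau read on the top: `τ(t(s))`. [folklore] -/
def tauS (h η s : ℝ) : ℝ := tauT η (tOfS h s)

/-- The plateau read in the cap chart: `τ(t(s(d)))`. [folklore] -/
def tauD (h η : ℝ) (d : ℂ) : ℝ := tauS h η (capS d)

variable {h η}

/-- Below `1 - η` the plateau is `0`. [folklore] -/
theorem tauT_of_le (hη : 0 < η) {t : ℝ} (ht : t ≤ 1 - η) : tauT η t = 0 :=
  Real.smoothTransition.zero_of_nonpos (div_nonpos_of_nonpos_of_nonneg (by linarith) (by linarith))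

/-- Above `1 + η` the plateau is `1`. [folklore] -/
theorem tauT_of_ge (hη : 0 < η) {t : ℝ} (ht : 1 + η ≤ t) : tauT η t = 1 :=
  Real.smoothTransition.one_of_one_le (by rw [le_div_iff₀ (by linarith)]; linarith)

/-- The plateau is smooth. [folklore] -/
theorem contDiff_tauT (η : ℝ) : ContDiff ℝ ∞ (tauT η) :=
  Real.smoothTransition.contDiff.comp (((contDiff_id.sub contDiff_const).add contDiff_const).div_const _)

/-- The plateau read on the top is smooth. [folklore] -/
theorem contDiff_tauS (h η : ℝ) : ContDiff ℝ ∞ (tauS h η) := (contDiff_tauT η).comp (contDiff_tOfS h)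

/-- The plateau read in the chart is smooth on the slit plane. [folklore] -/
theorem contDiffAt_tauD {d : ℂ} (hd : d ∈ slitPlane) : ContDiffAt ℝ ∞ (tauD h η) d :=
  (contDiff_tauS h η).contDiffAt.comp d (contDiffAt_capS hd)

/-- `tOfS` is antitone in `s` (for `h > 0`). [folklore] -/
theorem tOfS_le_tOfS (hh : 0 < h) {s₁ s₂ : ℝ} (hs : s₁ ≤ s₂) : tOfS h s₂ ≤ tOfS h s₁ := by
  have hπ := Real.pi_pos
  have : Real.arctan ((s₁ - 3 / 4) / h) ≤ Real.arctan ((s₂ - 3 / 4) / h) :=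
    Real.arctan_mono (div_le_div_of_nonneg_right (by linarith) hh.le)
  rw [tOfS, tOfS]
  have : Real.arctan ((s₁ - 3 / 4) / h) / (2 * π) ≤ Real.arctan ((s₂ - 3 / 4) / h) / (2 * π) :=
    div_le_div_of_nonneg_right this (by positivity)
  linarith

variable (h η) in
/-- **The half-width of the unsaturated window** of the plateau on the top: `w = h tan(2πη)`. [folklore] -/
def tauW : ℝ := h * Real.tan (2 * π * η)

/-- `tOfS (3/4 ± w) = 1 ∓ η` (`0 < η < 1/4`, `h ≠ 0`). [folklore] -/
theorem tOfS_window (hh : h ≠ 0) (hη : 0 < η) (hη' : η < 1 / 4) :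
    tOfS h (3 / 4 + tauW h η) = 1 - η ∧ tOfS h (3 / 4 - tauW h η) = 1 + η := by
  have h1 := tOfS_sTop hh (t := 1 - η) (by linarith) (by linarith)
  have h2 := tOfS_sTop hh (t := 1 + η) (by linarith) (by linarith)
  rw [sTop, show 2 * π * (1 - η - 1) = -(2 * π * η) by ring, Real.tan_neg] at h1
  rw [sTop, show 2 * π * (1 + η - 1) = 2 * π * η by ring] at h2
  refine ⟨?_, ?_⟩
  · rw [tauW, show 3 / 4 + h * Real.tan (2 * π * η) = 3 / 4 - h * -Real.tan (2 * π * η) by ring]; exact h1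
  · exact h2

/-- Above the window the plateau (read on the top) is `0`. [folklore] -/
theorem tauS_eq_zero (hh : 0 < h) (hη : 0 < η) (hη' : η < 1 / 4) {s : ℝ} (hs : 3 / 4 + tauW h η ≤ s) :
    tauS h η s = 0 := by
  have hle : tOfS h s ≤ 1 - η := by
    rw [← (tOfS_window hh.ne' hη hη').1]; exact tOfS_le_tOfS hh hs
  exact tauT_of_le hη hle

/-- Below the window the plateau (read on the top) is `1`. [folklore] -/
theorem tauS_eq_one (hh : 0 < h) (hη : 0 < η) (hη' : η < 1 / 4) {s : ℝ} (hs : s ≤ 3 / 4 - tauW h η) :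
    tauS h η s = 1 := by
  have hle : 1 + η ≤ tOfS h s := by
    rw [← (tOfS_window hh.ne' hη hη').2]; exact tOfS_le_tOfS hh hs
  exact tauT_of_ge hη hle

/-- `s(d) < 3/4 → re d < 0` (`arg d < -π/2`). [folklore] -/
theorem re_neg_of_capS_lt {d : ℂ} (hs : capS d < 3 / 4) : d.re < 0 := by
  have hπ := Real.pi_pos
  have ha : arg d < -(π / 2) := by
    rw [capS] at hs
    by_contra hcon
    have : -(π / 2) / (2 * π) + 1 ≤ arg d / (2 * π) + 1 := by gcongr; exact not_lt.1 hcon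
    rw [show -(π / 2) / (2 * π) + 1 = (3 : ℝ) / 4 by field_simp; ring] at this
    linarith
  by_contra hre
  have h := (Complex.neg_pi_div_two_le_arg_iff (z := d)).2 (Or.inl (not_lt.1 hre))
  linarith

/-- In the lower half-plane, `3/4 < s(d) → 0 < re d`. [folklore] -/
theorem re_pos_of_lt_capS {d : ℂ} (him : d.im < 0) (hs : 3 / 4 < capS d) : 0 < d.re := by
  have hπ := Real.pi_pos
  have ha : -(π / 2) < arg d := by
    rw [capS] at hs
    by_contra hcon
    have : arg d / (2 * π) + 1 ≤ -(π / 2) / (2 * π) + 1 := by gcongr; exact not_lt.1 hcon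
    rw [show -(π / 2) / (2 * π) + 1 = (3 : ℝ) / 4 by field_simp; ring] at this
    linarith
  rcases (Complex.neg_pi_div_two_le_arg_iff (z := d)).1 ha.le with hre | hi
  · rcases hre.lt_or_eq with hre | hre
    · exact hre
    · exfalso
      have : arg d = -(π / 2) := Complex.arg_eq_neg_pi_div_two_iff.2 ⟨hre.symm, him⟩
      linarith
  · linarith

/-- **Off the model slit the plateau agrees with the upper indicator near the point**: if `d` is in
the lower half-plane with `s(d)` outside a window `(3/4 - w', 3/4 + w')` strictly larger than the
unsaturated window (`w < w'`), then `1 - τ(d') = g₂(d')` for `d'` near `d`. [folklore] -/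
theorem one_sub_tauD_eventuallyEq_gUp (hh : 0 < h) (hη : 0 < η) (hη' : η < 1 / 4) {w' : ℝ}
    (hw : tauW h η < w') {d : ℂ} (him : d.im < 0)
    (hs : capS d ≤ 3 / 4 - w' ∨ 3 / 4 + w' ≤ capS d) :
    (fun d' ↦ 1 - tauD h η d') =ᶠ[𝓝 d] gUp := by
  have hπ := Real.pi_pos
  have hw0 : 0 < tauW h η := mul_pos hh (Real.tan_pos_of_pos_of_lt_pi_div_two (by positivity) (by nlinarith))
  have hslit : d ∈ slitPlane := Or.inr him.ne
  have hc : ContinuousAt capS d := (contDiffAt_capS hslit).continuousAt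
  rcases hs with hs | hs
  · have hre : d.re < 0 := re_neg_of_capS_lt (by linarith)
    filter_upwards [hc.eventually ((isOpen_lt continuous_id continuous_const).mem_nhds
        (show capS d < 3 / 4 - tauW h η by linarith)),
      (isOpen_lt Complex.continuous_re continuous_const).mem_nhds hre] with d' h1 h2
    have h1' : capS d' < 3 / 4 - tauW h η := h1
    rw [gUp, if_neg (not_lt.2 (le_of_lt h2)), tauD, tauS_eq_one hh hη hη' h1'.le, sub_self]
  · have hre : 0 < d.re := re_pos_of_lt_capS him (by linarith)
    filter_upwards [hc.eventually ((isOpen_lt continuous_const continuous_id).mem_nhds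
        (show 3 / 4 + tauW h η < capS d by linarith)),
      (isOpen_lt continuous_const Complex.continuous_re).mem_nhds hre] with d' h1 h2
    have h1' : 3 / 4 + tauW h η < capS d' := h1
    rw [gUp, if_pos h2, tauD, tauS_eq_zero hh hη hη' h1'.le, sub_zero]

end Plateau

/-! ### The smooth lift on the collar and its cut-off -/

section Lift

variable (tj h η : ℝ)

/-- **The smooth lift of `e^{i(ϑ + T)}` on the collar**: `Ŝ = -F_{1-τ}` with
`F_S = 2π g₁ (S - g₂) - ϑ̂` (`seamCorrG`), i.e. `Ŝ = ϑ̂ + 2π g₁ (τ - 1 + g₂)`; since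
`g₁, g₂ ∈ {0, 1}`, `e^{iŜ} = e^{iϑ} e^{iT}` with `T = 2π g₁ τ`. [folklore] -/
def modelLift (d : ℂ) : ℝ := -seamCorrG tj (fun d ↦ 1 - tauD h η d) d

/-- Unfolding the lift. [folklore] -/
theorem modelLift_eq (d : ℂ) :
    modelLift tj h η d = thetaHat (d - dCenter tj) + 2 * π * gOut tj d * (tauD h η d - 1 + gUp d) := by
  rw [modelLift, seamCorrG]
  ring

variable {tj h η}

/-- **The lift is smooth off the model slit**: in the lower half-plane, off the puncture, and on
the arc only where `s(d)` is outside a window strictly larger than the unsaturated one. [folklore] -/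
theorem contDiffAt_modelLift (htj : 0 < tj) (hh : 0 < h) (hη : 0 < η) (hη' : η < 1 / 4) {w' : ℝ}
    (hw : tauW h η < w') {d : ℂ} (him : d.im < 0) (hne : d ≠ dCenter tj)
    (harc : ‖d‖ = tj → capS d ≤ 3 / 4 - w' ∨ 3 / 4 + w' ≤ capS d) :
    ContDiffAt ℝ ∞ (modelLift tj h η) d := by
  have hS : ContDiffAt ℝ ∞ (fun d ↦ 1 - tauD h η d) d :=
    contDiffAt_const.sub (contDiffAt_tauD (Or.inr him.ne))
  exact (contDiffAt_seamCorrG htj him hne hS fun hn ↦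
    one_sub_tauD_eventuallyEq_gUp hh hη hη' hw him (harc hn)).neg

/-- **Exponentiating the lift**: `e^{-iŜ} (v/|v|) = e^{-iT}` with `T = 2π g₁ τ`
(from `exp_seamCorrG_mul_I` and `e^{2πi g₁} = 1`). [folklore] -/
theorem exp_neg_modelLift_mul_unit {d : ℂ} (hd : d ≠ dCenter tj) :
    exp (-(modelLift tj h η d * I)) * ((d - dCenter tj) / ‖d - dCenter tj‖) =
      exp (-((2 * π * gOut tj d * tauD h η d : ℝ) * I)) := by
  have h1 := exp_seamCorrG_mul_I (tj := tj) (fun d ↦ 1 - tauD h η d) hd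
  rw [modelLift]
  push_cast
  rw [neg_mul, neg_neg, h1]
  have hk : ∃ k : ℤ, gOut tj d = k := by
    unfold gOut; split_ifs; exacts [⟨1, by norm_num⟩, ⟨0, by norm_num⟩]
  obtain ⟨k, hk⟩ := hk
  have : ((2 * π * gOut tj d * (1 - tauD h η d) : ℝ) : ℂ) * I =
      -((2 * π * gOut tj d * tauD h η d : ℝ) * I) + (k : ℂ) * (2 * π * I) := by
    have hk' : (gOut tj d : ℂ) = k := by exact_mod_cast hk
    push_cast
    linear_combination (2 * π * I) * hk'
  rw [this, Complex.exp_add, Complex.exp_int_mul_two_pi_mul_I, mul_one]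
  congr 1
  push_cast
  ring

variable (tj h η) (r₁ r₂ : ℝ)

/-- **The cut-off lift** `S̃ = β(|d - d₀|) Ŝ`, smooth on the whole hole disc. [folklore] -/
def modelS (d : ℂ) : ℝ := capBlend r₁ r₂ ‖d - dCenter tj‖ * modelLift tj h η d

variable {tj h η r₁ r₂}

/-- On the collar (`|d - d₀| ≥ r₂`) the cut-off lift is the lift. [folklore] -/
theorem modelS_of_le_norm (h12 : r₁ < r₂) {d : ℂ} (hd : r₂ ≤ ‖d - dCenter tj‖) :
    modelS tj h η r₁ r₂ d = modelLift tj h η d := by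
  rw [modelS, capBlend, Real.smoothTransition.one_of_one_le ((one_le_div (by linarith)).2 (by linarith)),
    one_mul]

/-- Near the puncture (`|d - d₀| ≤ r₁`) the cut-off lift vanishes. [folklore] -/
theorem modelS_of_norm_le (h12 : r₁ < r₂) {d : ℂ} (hd : ‖d - dCenter tj‖ ≤ r₁) :
    modelS tj h η r₁ r₂ d = 0 := by
  rw [modelS, capBlend, Real.smoothTransition.zero_of_nonpos
    (div_nonpos_of_nonpos_of_nonneg (by linarith) (by linarith)), zero_mul]

/-- **The cut-off lift is smooth** at every `d` provided the lift is smooth on `|d - d₀| ≥ r₁`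
(`0 < r₁ < r₂`). [folklore] -/
theorem contDiffAt_modelS (h1 : 0 < r₁) (h12 : r₁ < r₂)
    (hF : ∀ d', r₁ ≤ ‖d' - dCenter tj‖ → ContDiffAt ℝ ∞ (modelLift tj h η) d') (d : ℂ) :
    ContDiffAt ℝ ∞ (modelS tj h η r₁ r₂) d := by
  have hcn : Continuous fun d : ℂ ↦ ‖d - dCenter tj‖ := by fun_prop
  rcases lt_or_ge ‖d - dCenter tj‖ r₁ with h0 | h0
  · have hev : modelS tj h η r₁ r₂ =ᶠ[𝓝 d] fun _ ↦ 0 := by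
      filter_upwards [(isOpen_lt hcn continuous_const).mem_nhds h0] with d' hd'
      exact modelS_of_norm_le h12 hd'.le
    exact contDiffAt_const.congr_of_eventuallyEq hev
  · have hd : d ≠ dCenter tj := by
      rintro rfl; rw [sub_self, norm_zero] at h0; linarith
    have hb : ContDiffAt ℝ ∞ (fun d' ↦ capBlend r₁ r₂ ‖d' - dCenter tj‖) d :=
      (Real.smoothTransition.contDiff.comp ((contDiff_id.sub contDiff_const).div_const _)).contDiffAt.comp
        d (contDiffAt_norm ℝ (sub_ne_zero.2 hd) |>.comp d (contDiff_id.sub contDiff_const).contDiffAt)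
    exact hb.mul (hF d h0)

end Lift

/-! ### The identification `Λ` -/

section Lambda

variable (c : ℝ) (S : ℂ → ℝ)

/-- **The handle identification** `Λ(v, ℓ₂) = (ζ, β) = (c v e^{-i(S̃(d₀+v) - ℓ₂)}, S̃(d₀+v) - ℓ₂)`:
hole coordinates (cap-chart offset `v` of the base point, fibre angle `ℓ₂`) to (Cartesian
coordinate `ζ` on the disc `D`, normal angle `β`). Here `S : ℂ → ℝ` is the cut-off lift as a
function of the offset `v` (i.e. `S v = modelS … (d₀ + v)`). [cite: GompfAGT2010, Lemma 2.2 (Φ = N ∪ h, the 2-handle attached along γ with framing ∓1)] -/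
def fishLambda (p : ℂ × ℝ) : ℂ × ℝ :=
  ((c : ℂ) * p.1 * exp (-((S p.1 - p.2 : ℝ) : ℂ) * I), S p.1 - p.2)

/-- **The inverse identification** `Λ⁻¹(ζ, β) = (ζ e^{iβ}/c, S̃(ζ e^{iβ}/c) - β)`. [folklore] -/
def fishLambdaInv (q : ℂ × ℝ) : ℂ × ℝ :=
  (q.1 * exp ((q.2 : ℂ) * I) / c, S (q.1 * exp ((q.2 : ℂ) * I) / c) - q.2)

variable {c S}

/-- `Λ⁻¹ ∘ Λ = id` (`c ≠ 0`). [folklore] -/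
theorem fishLambdaInv_fishLambda (hc : c ≠ 0) (p : ℂ × ℝ) :
    fishLambdaInv c S (fishLambda c S p) = p := by
  obtain ⟨v, l⟩ := p
  have hc' : (c : ℂ) ≠ 0 := by exact_mod_cast hc
  have hv : (c : ℂ) * v * exp (-((S v - l : ℝ) : ℂ) * I) * exp (((S v - l : ℝ) : ℂ) * I) / c = v := by
    rw [mul_assoc, ← Complex.exp_add, show -((S v - l : ℝ) : ℂ) * I + ((S v - l : ℝ) : ℂ) * I = 0 by ring,
      Complex.exp_zero, mul_one, mul_div_cancel_left₀ _ hc']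
  simp only [fishLambdaInv, fishLambda, hv]
  refine Prod.ext rfl ?_
  show S v - (S v - l) = l
  ring

/-- `Λ ∘ Λ⁻¹ = id` (`c ≠ 0`). [folklore] -/
theorem fishLambda_fishLambdaInv (hc : c ≠ 0) (q : ℂ × ℝ) :
    fishLambda c S (fishLambdaInv c S q) = q := by
  obtain ⟨ζ, β⟩ := q
  have hc' : (c : ℂ) ≠ 0 := by exact_mod_cast hc
  simp only [fishLambda, fishLambdaInv]
  refine Prod.ext ?_ ?_
  · show (c : ℂ) * (ζ * exp ((β : ℂ) * I) / c) *
      exp (-((S (ζ * exp ((β : ℂ) * I) / c) - (S (ζ * exp ((β : ℂ) * I) / c) - β) : ℝ) : ℂ) * I) = ζ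
    rw [show (S (ζ * exp ((β : ℂ) * I) / c) - (S (ζ * exp ((β : ℂ) * I) / c) - β) : ℝ) = β by ring,
      mul_div_cancel₀ _ hc', mul_assoc, ← Complex.exp_add, show (β : ℂ) * I + -(β : ℂ) * I = 0 by ring,
      Complex.exp_zero, mul_one]
  · show S (ζ * exp ((β : ℂ) * I) / c) - (S (ζ * exp ((β : ℂ) * I) / c) - β) = β
    ring

/-- `Λ` is smooth where `S` is. [folklore] -/
theorem contDiffAt_fishLambda {p : ℂ × ℝ} (hS : ContDiffAt ℝ ∞ S p.1) :
    ContDiffAt ℝ ∞ (fishLambda c S) p := by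
  have h1 : ContDiffAt ℝ ∞ (fun p : ℂ × ℝ ↦ S p.1 - p.2) p := (hS.comp p contDiffAt_fst).sub contDiffAt_snd
  have h2 : ContDiffAt ℝ ∞ (fun p : ℂ × ℝ ↦ exp (-((S p.1 - p.2 : ℝ) : ℂ) * I)) p :=
    Complex.contDiff_exp.contDiffAt.comp p (((ofRealCLM.contDiff.contDiffAt.comp p h1).neg).mul contDiffAt_const)
  exact ((contDiffAt_const.mul contDiffAt_fst).mul h2).prodMk h1

/-- `Λ⁻¹` is smooth where `S` is (at the relevant point). [folklore] -/
theorem contDiffAt_fishLambdaInv {q : ℂ × ℝ} (hS : ContDiffAt ℝ ∞ S (q.1 * exp ((q.2 : ℂ) * I) / c)) :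
    ContDiffAt ℝ ∞ (fishLambdaInv c S) q := by
  have h1 : ContDiffAt ℝ ∞ (fun q : ℂ × ℝ ↦ q.1 * exp ((q.2 : ℂ) * I) / c) q :=
    (contDiffAt_fst.mul (Complex.contDiff_exp.contDiffAt.comp q
      ((ofRealCLM.contDiff.contDiffAt.comp q contDiffAt_snd).mul contDiffAt_const))).div_const _
  exact h1.prodMk ((hS.comp q h1).sub contDiffAt_snd)

/-- The norm of the disc coordinate: `|ζ| = |c| |v|`. [folklore] -/
theorem norm_fishLambda_fst (p : ℂ × ℝ) : ‖(fishLambda c S p).1‖ = |c| * ‖p.1‖ := by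
  rw [fishLambda]
  simp only
  rw [norm_mul, norm_mul, Complex.norm_real, Real.norm_eq_abs,
    show -((S p.1 - p.2 : ℝ) : ℂ) * I = ↑(-(S p.1 - p.2)) * I by push_cast; ring,
    norm_exp_ofReal_mul_I, mul_one]

/-- **The collar identity for the direction of the disc coordinate**:
`ζ = c |v| · (v/|v|) e^{-iS̃} e^{iℓ₂}`; combined with `exp_neg_modelLift_mul_unit` (where
`S̃ = Ŝ`) this says the angle of `ζ` is `ℓ₂ - T`, the trivialised fibre coordinate. [folklore] -/
theorem fishLambda_fst_eq (p : ℂ × ℝ) :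
    (fishLambda c S p).1 = (c : ℂ) * ‖p.1‖ * ((exp (-(S p.1 * I)) * (p.1 / ‖p.1‖)) * exp ((p.2 : ℂ) * I)) := by
  rcases eq_or_ne p.1 0 with h0 | h0
  · simp [fishLambda, h0]
  · have hn : (‖p.1‖ : ℂ) ≠ 0 := by exact_mod_cast (norm_pos_iff.2 h0).ne'
    rw [fishLambda]
    simp only
    rw [show -((S p.1 - p.2 : ℝ) : ℂ) * I = -(S p.1 * I) + (p.2 : ℂ) * I by push_cast; ring,
      Complex.exp_add]
    field_simp

end Lambda

end Literature.Topology.FourManifolds
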